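import Summits.KontsevichZagierPeriods.KontsevichZagierPeriods.Theses.TorsionLogs
import Literature.NumberTheory.Transcendental.KZKernelConjectureForms

/-!
# ON-PATH LEMMA (F4) for the rung `NeronDistribution`: the summit implies the rung

`neronDistribution_of_kontsevichZagierPeriods : KontsevichZagierPeriods → NeronDistribution` (sorry-free):
the summit in kernel form (`KZKernelConjecture`, `ker eval = relations`, equivalent to Conjecture 1 by the landed
`kzKernelConjecture_iff_isRational`) applied to the tied distribution element, whose evaluation vanishes by the
rung's value hypothesis (pure bookkeeping: `KZ.eval_of`, linearity of `eval`). No analysis, no conjecture besides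
the summit itself.  Self-contained: verbatim copies of the two `def`s of `Lines/NeronDistribution.lean` in the
namespace `…NeronDistribution.OnPath`.
-/

open Set MeasureTheory
open Literature.NumberTheory.Transcendental

namespace Summit.KontsevichZagierPeriods.KontsevichZagierPeriods.Cruxes.TorsionSectorComplete.NeronDistribution.OnPath

/-- MEMBER (verbatim copy of `Lines/NeronDistribution.lean`). -/
def NeronDistributionMember (regular : Bool) : Prop :=
  ∀ (g₂ g₃ e₁ xP yP xQ yQ B : ℝ) (N a n : ℕ) (ε k μ c : ℤ) (f : ℝ → ℝ),
    (∀ x, f x = 4 * x ^ 3 - g₂ * x - g₃) → g₂ ^ 3 - 27 * g₃ ^ 2 ≠ 0 → f e₁ = 0 → 0 < e₁ →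
    (∀ x, e₁ < x → 0 < f x) → e₁ < xP → yP ^ 2 = f xP →
    (∀ hns : (⟨0, 0, 0, -g₂ / 4, -g₃ / 4⟩ : WeierstrassCurve ℝ).toAffine.Nonsingular xP (yP / 2),
      addOrderOf (WeierstrassCurve.Affine.Point.some xP (yP / 2) hns) = N) →
    (N : ℝ) * (∫ x in Set.Ioi xP, (Real.sqrt (f x))⁻¹) = a * (2 * ∫ x in Set.Ioi e₁, (Real.sqrt (f x))⁻¹) →
    2 ≤ n → (if regular then e₁ < xQ else xQ = e₁) → yQ ^ 2 = f xQ →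
    (∀ (hnsP : (⟨0, 0, 0, -g₂ / 4, -g₃ / 4⟩ : WeierstrassCurve ℝ).toAffine.Nonsingular xP (yP / 2))
       (hnsQ : (⟨0, 0, 0, -g₂ / 4, -g₃ / 4⟩ : WeierstrassCurve ℝ).toAffine.Nonsingular xQ (yQ / 2)),
      n • WeierstrassCurve.Affine.Point.some xP (yP / 2) hnsP =
        WeierstrassCurve.Affine.Point.some xQ (yQ / 2) hnsQ) →
    (ε = 1 ∨ ε = -1) →
    (∫ x in Set.Ioi xQ, (Real.sqrt (f x))⁻¹) =
      ε * n * (∫ x in Set.Ioi xP, (Real.sqrt (f x))⁻¹) + k * (2 * ∫ x in Set.Ioi e₁, (Real.sqrt (f x))⁻¹) →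
    μ = 1 - ε * n - 2 * k →
    ∀ (rIP rIQ rRQ rP : Literature.NumberTheory.Transcendental.KZ.IntegralRep 2)
      (rB : Literature.NumberTheory.Transcendental.KZ.IntegralRep 1),
    rIP.domain = {z | e₁ < z 1 ∧ z 1 < z 0 ∧ z 0 < xP} →
    Set.EqOn rIP.integrand (fun z => z 1 / (Real.sqrt (f (z 1)) * Real.sqrt (f (z 0)))) rIP.domain →
    rIQ.domain = {z | e₁ < z 1 ∧ z 1 < z 0 ∧ z 0 < xQ} →
    Set.EqOn rIQ.integrand (fun z => z 1 / (Real.sqrt (f (z 1)) * Real.sqrt (f (z 0)))) rIQ.domain →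
    rRQ.domain = {z | e₁ < z 0 ∧ z 0 < xQ ∧ e₁ < z 1} →
    Set.EqOn rRQ.integrand
      (fun z => (Real.sqrt (f (z 0)))⁻¹ * ((g₂ * z 1 + 2 * g₃) / (2 * (z 1) ^ 2 * Real.sqrt (f (z 1))))) rRQ.domain →
    rP.domain = {z | e₁ < z 0 ∧ e₁ < z 1} →
    Set.EqOn rP.integrand
      (fun z => (Real.sqrt (f (z 0)))⁻¹ * ((g₂ * z 1 + 2 * g₃) / (2 * (z 1) ^ 2 * Real.sqrt (f (z 1))))) rP.domain →
    1 < B → rB.domain = {t | 1 < t 0 ∧ t 0 < B} → Set.EqOn rB.integrand (fun t => (t 0)⁻¹) rB.domain →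
    4 * rIQ.value - 4 * (n : ℝ) ^ 2 * rIP.value + 2 * (μ : ℝ) * rRQ.value - (μ : ℝ) ^ 2 * rP.value = c * rB.value →
    (4 : ℤ) • Literature.NumberTheory.Transcendental.KZ.of rIQ
      - ((4 * n ^ 2 : ℕ) : ℤ) • Literature.NumberTheory.Transcendental.KZ.of rIP
      + (2 * μ) • Literature.NumberTheory.Transcendental.KZ.of rRQ
      - (μ ^ 2) • Literature.NumberTheory.Transcendental.KZ.of rP
      - c • Literature.NumberTheory.Transcendental.KZ.of rB ∈ Literature.NumberTheory.Transcendental.KZ.relations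

/-- THE RUNG (verbatim copy). -/
def NeronDistribution : Prop := ∀ regular : Bool, NeronDistributionMember regular

/-- **ON-PATH (F4): the summit implies every member of the rung.** [cite: KontsevichZagier2001, §1.2] -/
theorem neronDistributionMember_of_kontsevichZagierPeriods (h : _root_.KontsevichZagierPeriods) (regular : Bool) :
    NeronDistributionMember regular := by
  intro g₂ g₃ e₁ xP yP xQ yQ B N a n ε k μ c f hf hΔ he₁ he₁pos hfpos hxP hyP hord htor hn hxQ hyQ hmul hε
    hsheet hμ rIP rIQ rRQ rP rB hIPd hIPi hIQd hIQi hRQd hRQi hPd hPi hB1 hBd hBi hval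
  have hK : KZKernelConjecture := kzKernelConjecture_iff_isRational.mpr (KontsevichZagierPeriods_iff.mp h)
  refine hK _ ?_
  simp only [map_sub, map_add, map_zsmul, KZ.eval_of, zsmul_eq_mul, Int.cast_pow, Int.cast_natCast,
    Int.cast_mul, Int.cast_ofNat, Nat.cast_mul, Nat.cast_pow, Nat.cast_ofNat]
  linear_combination hval

/-- **ON-PATH (F4): the summit implies the rung.** [cite: KontsevichZagier2001, §1.2] -/
theorem neronDistribution_of_kontsevichZagierPeriods (h : _root_.KontsevichZagierPeriods) : NeronDistribution :=
  fun regular => neronDistributionMember_of_kontsevichZagierPeriods h regular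

end Summit.KontsevichZagierPeriods.KontsevichZagierPeriods.Cruxes.TorsionSectorComplete.NeronDistribution.OnPath
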